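import Literature.AnabelianGeometry.SemiGraphs.BranchSubgroupLemmas

/-!
# The branch group `Π_b` acts on a fibre of `B(𝒢)` as on the fibre of the edge object ([SemiAnbd] §2)

Mochizuki, *Semi-graphs of anabelioids*, Publ. RIMS **42** (2006) 221–322, §2, Definition 2.1 and
Definition 2.2 (i), author's manuscript pp. 22–24 [cite: MochizukiSemiAnbd2006, Def. 2.2(i) p.23]:
an object of `B(𝒢)` is a system `{S_v, T_e, ψ_b : b^* S_v ⥲ T_e}`, and "the edges of `𝔾′` that lie
over an edge `e` correspond to the connected components of `T_e`", the image of `Π_b` in `Π_𝒢` being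
the decomposition group (Remark 2.2.1, p. 24: "stabilizer").  The base-level EDGE entry of the finite
étale covering dictionary (deferred in `FiniteEtaleCoveringDictionary.lean`, module docstring, last
paragraph) is the following element-level statement, PROVED here (abc-iut, layer L3, row F-1477 /
SUBDAG-SemiAnbd-Ex210 «Rmk 2.10.1», step (E1)):

for `A ∈ B(𝒢)`, a branch `b ∈ e` abutting to `v`, basepoints `F` of `𝒢_v`, `F_e` of `𝒢_e` and a
transport `α : b^* ⋙ F_e ≅ F`, the bijection `F(S_v) ≅ F_e(b^* S_v) ≅ F_e(T_e)` (first `α⁻¹`, then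
`F_e(ψ_b)`) intertwines the action of the branch subgroup `Π_b = Π_b^{F_e, α} ⊆ Π_v = Aut F`
(`SemiGraphOfAnabelioids.branchSubgroup`) on the vertex fibre `F(S_v)` — which is the fibre
`(ρ_v ⋙ F)(A)` of `A` on which `Π_𝒢` acts through `Π_v → Π_𝒢` — with the action of `Π_e = Aut F_e`
on `F_e(T_e)` (`map_ψ_branch_smul`; object-level form `hom_app_branch_smul` /
`stabilizer_pullback_eq_comap` for any `S ∈ 𝒢_v`: `α_S` intertwines `Π_e ↷ F_e(b^* S)` with
`Π_b ↷ F(S)`, so point stabilisers correspond).  Consequences: `Π_b` acts trivially on the fibre of `A` when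
`Π_e` acts trivially on `F_e(T_e)` ("`A` is trivial over `e`"), and non-trivially when `Π_e` acts
non-trivially (`branchSubgroup_smul_eq_self_of_edge_trivial`,
`exists_branchSubgroup_smul_ne_of_edge_nontrivial`), with the kernel forms in `Π_𝒢`
(`map_piVToPi_branchSubgroup_le_ker_of_edge_trivial`,
`not_map_piVToPi_branchSubgroup_le_ker_of_edge_nontrivial`).

Proof-only companion (no new notions); everything is naturality of `σ ∈ Aut F_e` at `ψ_b`.
Nothing here takes a side on [IUTchIII] Cor. 3.12.
-/

namespace Literature.AnabelianGeometry.SemiGraphs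

open CategoryTheory CategoryTheory.PreGaloisCategory
open Literature.AnabelianGeometry.Anabelioids

universe v₁ u₁ u w

namespace SemiGraphOfAnabelioids

variable {𝒢 : SemiGraphOfAnabelioids.{v₁, u₁, u}} (A : 𝒢.BObj) {v : 𝒢.graph.Vertex}
  (F : 𝒢.V v ⥤ FintypeCat.{w}) (b : 𝒢.graph.Branch) (h : 𝒢.graph.abuts b = some v)
  (Fe : 𝒢.E (𝒢.graph.edgeOf b) ⥤ FintypeCat.{w}) (α : (𝒢.pull b v h).pullback ⋙ Fe ≅ F)

/-- The element of `Π_v = Aut F` obtained from `σ ∈ Π_e = Aut F_e` along the branch `b` and the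
transport `α` acts on the vertex fibre `F(S_v)` by `α ∘ σ_{b^* S_v} ∘ α⁻¹`.
[cite: MochizukiSemiAnbd2006, Def. 2.1 pp.23-24] -/
theorem branch_smul_apply (σ : 𝒢.PiB b Fe) (x : F.obj (A.S v)) :
    (Aut.autMulEquivOfIso α (𝒢.piBToPiV b v h Fe σ)) • x =
      α.hom.app (A.S v) (σ.hom.app ((𝒢.pull b v h).pullback.obj (A.S v))
        (α.inv.app (A.S v) x)) := by
  rw [mulAction_def]
  change (α.inv ≫ (pi1Map (𝒢.pull b v h).pullback Fe σ).hom ≫ α.hom).app (A.S v) x = _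
  simp only [NatTrans.comp_app, FintypeCat.comp_apply, pi1Map_hom_app]
  rfl

/-- `α⁻¹ ∘ α = id` on points of the vertex fibre. [folklore] -/
private theorem inv_app_hom_app (X : 𝒢.V v) (y : ((𝒢.pull b v h).pullback ⋙ Fe).obj X) :
    α.inv.app X (α.hom.app X y) = y := by
  rw [← FintypeCat.comp_apply (α.hom.app X) (α.inv.app X), ← NatTrans.comp_app, α.hom_inv_id,
    NatTrans.id_app, FintypeCat.id_apply]

/-- `α ∘ α⁻¹ = id` on points of the vertex fibre. [folklore] -/
private theorem hom_app_inv_app (X : 𝒢.V v) (x : F.obj X) :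
    α.hom.app X (α.inv.app X x) = x := by
  rw [← FintypeCat.comp_apply (α.inv.app X) (α.hom.app X), ← NatTrans.comp_app, α.inv_hom_id,
    NatTrans.id_app, FintypeCat.id_apply]

/-- For ANY object `S` of `𝒢_v` (no edge object needed): the transport `α_S : F_e(b^* S) ⥲ F(S)`
intertwines the action of `σ ∈ Π_e = Aut F_e` on `F_e(b^* S)` with the action of its image
`σ^{b,α} ∈ Π_b^{F_e,α} ⊆ Π_v` on `F(S)` — "`Π_b → Π_v` is induced by `b^*`".
[cite: MochizukiSemiAnbd2006, Def. 2.1 pp.23-24] -/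
theorem hom_app_branch_smul (S : 𝒢.V v) (σ : 𝒢.PiB b Fe)
    (y : Fe.obj ((𝒢.pull b v h).pullback.obj S)) :
    α.hom.app S (σ • y) = (Aut.autMulEquivOfIso α (𝒢.piBToPiV b v h Fe σ)) • α.hom.app S y := by
  have h1 : α.inv.app S (α.hom.app S y) = y := inv_app_hom_app F b h Fe α S y
  change α.hom.app S (σ.hom.app _ y) =
    (α.inv ≫ (pi1Map (𝒢.pull b v h).pullback Fe σ).hom ≫ α.hom).app S (α.hom.app S y)
  simp only [NatTrans.comp_app, FintypeCat.comp_apply, pi1Map_hom_app]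
  congr 2
  exact h1.symm

/-- Consequently the stabiliser in `Π_e` of a point `y ∈ F_e(b^* S)` is the preimage, under
`Π_e → Π_b^{F_e,α} ⊆ Π_v`, of the stabiliser in `Π_v` of the transported point `α_S(y) ∈ F(S)`.
[cite: MochizukiSemiAnbd2006, Def. 2.1 pp.23-24] -/
theorem stabilizer_pullback_eq_comap (S : 𝒢.V v) (y : Fe.obj ((𝒢.pull b v h).pullback.obj S)) :
    MulAction.stabilizer (𝒢.PiB b Fe) y =
      (MulAction.stabilizer (𝒢.PiV v F) (α.hom.app S y)).comap
        ((Aut.autMulEquivOfIso α).toMonoidHom.comp (𝒢.piBToPiV b v h Fe)) := by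
  ext σ
  rw [MulAction.mem_stabilizer_iff, Subgroup.mem_comap, MulAction.mem_stabilizer_iff]
  change _ ↔ (Aut.autMulEquivOfIso α (𝒢.piBToPiV b v h Fe σ)) • α.hom.app S y = α.hom.app S y
  rw [← hom_app_branch_smul]
  constructor
  · intro hσ; rw [hσ]
  · intro hσ; exact (Function.LeftInverse.injective (inv_app_hom_app F b h Fe α S)) hσ

/-- **The comparison `F(S_v) → F_e(T_e)`, `x ↦ F_e(ψ_b)(α⁻¹ x)`, intertwines the branch action with
the action of `Π_e` on the fibre of the edge object**: for `σ ∈ Aut F_e`,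
`F_e(ψ_b)(α⁻¹(σ^{b,α} · x)) = σ · F_e(ψ_b)(α⁻¹ x)`. [cite: MochizukiSemiAnbd2006, Def. 2.2(i) p.23] -/
theorem map_ψ_branch_smul (σ : 𝒢.PiB b Fe) (x : F.obj (A.S v)) :
    Fe.map (A.ψ b v h).hom
        (α.inv.app (A.S v) ((Aut.autMulEquivOfIso α (𝒢.piBToPiV b v h Fe σ)) • x)) =
      σ • Fe.map (A.ψ b v h).hom (α.inv.app (A.S v) x) := by
  rw [branch_smul_apply, inv_app_hom_app, mulAction_naturality, mulAction_def]

/-- The comparison map `x ↦ F_e(ψ_b)(α⁻¹ x)` is injective (both steps are bijections).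
[folklore] -/
private theorem comparison_injective :
    Function.Injective fun x : F.obj (A.S v) => Fe.map (A.ψ b v h).hom (α.inv.app (A.S v) x) := by
  intro x y hxy
  have h1 : Function.Injective (Fe.map (A.ψ b v h).hom) :=
    ((Fe ⋙ FintypeCat.incl).mapIso (A.ψ b v h)).toEquiv.injective
  have h2 : Function.Injective (α.inv.app (A.S v)) := by
    intro a a' haa'
    have := congrArg (α.hom.app (A.S v)) haa'
    rwa [hom_app_inv_app, hom_app_inv_app] at this
  exact h2 (h1 hxy)

/-- The comparison map `x ↦ F_e(ψ_b)(α⁻¹ x)` is surjective (both steps are bijections).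
[folklore] -/
private theorem comparison_surjective :
    Function.Surjective fun x : F.obj (A.S v) => Fe.map (A.ψ b v h).hom (α.inv.app (A.S v) x) := by
  intro y
  have h1 : Function.Surjective (Fe.map (A.ψ b v h).hom) :=
    ((Fe ⋙ FintypeCat.incl).mapIso (A.ψ b v h)).toEquiv.surjective
  obtain ⟨z, rfl⟩ := h1 y
  exact ⟨α.hom.app (A.S v) z, by simp only [inv_app_hom_app]⟩

/-- **(K1) If `A` is trivial over `e` then `Π_b` acts trivially on the fibre of `A`:** if `Π_e = Aut F_e`
fixes every point of `F_e(T_e)`, every element of the branch subgroup `Π_b^{F_e, α} ⊆ Π_v` fixes every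
point of `F(S_v)`. [cite: MochizukiSemiAnbd2006, Rem. 2.2.1 p.24] -/
theorem branchSubgroup_smul_eq_self_of_edge_trivial
    (htriv : ∀ (σ : Aut Fe) (y : Fe.obj (A.T (𝒢.graph.edgeOf b))), σ • y = y)
    {g : 𝒢.PiV v F} (hg : g ∈ 𝒢.branchSubgroup F b h Fe α) (x : F.obj (A.S v)) : g • x = x := by
  obtain ⟨σ, rfl⟩ := (𝒢.mem_branchSubgroup_iff F b h Fe α g).mp hg
  apply comparison_injective A F b h Fe α
  change Fe.map (A.ψ b v h).hom (α.inv.app (A.S v) (_ • x)) = _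
  rw [map_ψ_branch_smul, htriv]

/-- **(K2) If `A` is non-trivial over `e` then `Π_b` acts non-trivially on the fibre of `A`:** if some
`σ ∈ Aut F_e` moves a point of `F_e(T_e)`, some element of the branch subgroup `Π_b^{F_e, α} ⊆ Π_v`
moves a point of `F(S_v)`. [cite: MochizukiSemiAnbd2006, Rem. 2.2.1 p.24] -/
theorem exists_branchSubgroup_smul_ne_of_edge_nontrivial
    (hnt : ∃ (σ : Aut Fe) (y : Fe.obj (A.T (𝒢.graph.edgeOf b))), σ • y ≠ y) :
    ∃ g ∈ 𝒢.branchSubgroup F b h Fe α, ∃ x : F.obj (A.S v), g • x ≠ x := by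
  obtain ⟨σ, y, hy⟩ := hnt
  obtain ⟨x, rfl⟩ := comparison_surjective A F b h Fe α y
  refine ⟨Aut.autMulEquivOfIso α (𝒢.piBToPiV b v h Fe σ),
    (𝒢.mem_branchSubgroup_iff F b h Fe α _).mpr ⟨σ, rfl⟩, x, fun hx => hy ?_⟩
  have := map_ψ_branch_smul A F b h Fe α σ x
  dsimp only at this ⊢
  rw [hx] at this
  exact this.symm

/-! ### Kernel forms in `Π_𝒢` (basepoint through `v`) -/

/-- Through `Π_v → Π_𝒢 = Aut(ρ_v ⋙ F)`, an element of `Π_v` acts on the fibre `(ρ_v ⋙ F)(A) = F(S_v)`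
of `A` by its own action. [cite: MochizukiSemiAnbd2006, Def. 2.1 p.23] -/
theorem piVToPi_smul (g : 𝒢.PiV v F) (x : (𝒢.ρ v ⋙ F).obj A) :
    (𝒢.piVToPi v F g) • x = g • (show F.obj (A.S v) from x) := rfl

/-- **(K1), kernel form:** if `A` is trivial over `e`, the image of `Π_b` in `Π_𝒢` lies in the kernel of
the action of `Π_𝒢` on the fibre of `A` (i.e. in the open normal subgroup defined by `A`).
[cite: MochizukiSemiAnbd2006, Rem. 2.2.1 p.24] -/
theorem map_piVToPi_branchSubgroup_le_ker_of_edge_trivial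
    (htriv : ∀ (σ : Aut Fe) (y : Fe.obj (A.T (𝒢.graph.edgeOf b))), σ • y = y) :
    (𝒢.branchSubgroup F b h Fe α).map (𝒢.piVToPi v F) ≤
      (MulAction.toPermHom (𝒢.Pi v F) ((𝒢.ρ v ⋙ F).obj A)).ker := by
  rintro _ ⟨g, hg, rfl⟩
  rw [MonoidHom.mem_ker]
  ext x
  rw [MulAction.toPermHom_apply, MulAction.toPerm_apply, piVToPi_smul, Equiv.Perm.coe_one, id_eq]
  exact branchSubgroup_smul_eq_self_of_edge_trivial A F b h Fe α htriv hg x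

/-- **(K2), kernel form:** if `A` is non-trivial over `e`, the image of `Π_b` in `Π_𝒢` is NOT contained
in the kernel of the action of `Π_𝒢` on the fibre of `A`. [cite: MochizukiSemiAnbd2006, Rem. 2.2.1 p.24] -/
theorem not_map_piVToPi_branchSubgroup_le_ker_of_edge_nontrivial
    (hnt : ∃ (σ : Aut Fe) (y : Fe.obj (A.T (𝒢.graph.edgeOf b))), σ • y ≠ y) :
    ¬ (𝒢.branchSubgroup F b h Fe α).map (𝒢.piVToPi v F) ≤
      (MulAction.toPermHom (𝒢.Pi v F) ((𝒢.ρ v ⋙ F).obj A)).ker := by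
  obtain ⟨g, hg, x, hx⟩ := exists_branchSubgroup_smul_ne_of_edge_nontrivial A F b h Fe α hnt
  intro hle
  have hk := hle (Subgroup.mem_map_of_mem (𝒢.piVToPi v F) hg)
  rw [MonoidHom.mem_ker] at hk
  have := congrArg (fun p : Equiv.Perm ((𝒢.ρ v ⋙ F).obj A) => p x) hk
  simp only [MulAction.toPermHom_apply, MulAction.toPerm_apply, Equiv.Perm.coe_one, id_eq] at this
  exact hx this

/-- The branch subgroup mapped into `Π_𝒢` is the range of `Π_b → Π_𝒢` transported along `α`
(the subgroup `remark_2_10_1` speaks about, for the transport `ρ_v ◃ α`): bookkeeping identity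
`(Π_b^{F_e,α}).map (Π_v → Π_𝒢) = (Aut(ρ_v ◃ α) ∘ (Π_b → Π_𝒢))(Π_b)`.
[cite: MochizukiSemiAnbd2006, Def. 2.1 p.23] -/
theorem map_piVToPi_branchSubgroup_eq_range :
    (𝒢.branchSubgroup F b h Fe α).map (𝒢.piVToPi v F) =
      ((Aut.autMulEquivOfIso (Functor.isoWhiskerLeft (𝒢.ρ v) α)).toMonoidHom.comp
        (𝒢.piBToPi b v h Fe)).range := by
  rw [branchSubgroup_eq_map_range, Subgroup.map_map, ← MonoidHom.range_comp]
  rfl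

end SemiGraphOfAnabelioids

end Literature.AnabelianGeometry.SemiGraphs
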